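import Mathlib.Geometry.Manifold.Instances.Sphere
import Mathlib.Geometry.Manifold.Algebra.LieGroup
import Mathlib.Geometry.Manifold.ContMDiff.Constructions
import Mathlib.Geometry.Manifold.ContMDiff.NormedSpace
import Mathlib.Analysis.InnerProductSpace.PiL2
import HarnessLib

/-!
# Fibred regluing maps by rotations: the gluing maps of Luttinger and `n`-torus surgeries

Topic `Literature/Topology/FourManifolds` (fact seat of the Seiberg–Witten leaf
`Literature.Barriers.SmoothPoincare4.akhmedovPark2010_lemma8_invariants`; companion of
`TubeRegluing.lean`).  The existence theorem `exists_tubeRegluing_boundaryGluingData` reglues a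
tube `T : F × ℝ² → Y` by a pair of mutually inverse *fibred regluing maps* `Ψ`, `Ψ'` of
`F × (ℝ² ∖ 0)` — `C^∞` off the zero section, radius preserving, `Ψ` conical.  This file
supplies the pairs used by the surgeries of A. Akhmedov, B. D. Park, Invent. Math. 181 (2010), §2
(Luttinger surgeries `(T, γ, ±1)`) and §4, §9 (the `m`-torus surgery of `Z''(1, m)`): for a
`p/q`-surgery with `q = 1` on a torus `T` along a curve `γ ⊂ T` the gluing diffeomorphism
`T² × ∂D² → ∂νT` may be taken to be the identity on the torus factor and, on the normal circle
over the point `f ∈ T`, the rotation by `χ(f)ⁿ`, where `χ : T → S¹` is the angular coordinate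
dual to `γ` (the new meridian is `μ + n γ'`; R. Gompf, A. Stipsicz, *4-Manifolds and Kirby
Calculus* (1999), §8.3 p. 311; S. Baldridge, P. Kirk, *A symplectic manifold homeomorphic but not
diffeomorphic to `ℂℙ² # 3ℂℙ²bar`*, Geom. Topol. 12 (2008), §2.1–2.2, the gluing map of a
`p/q`-surgery).  Abstractly: for ANY smooth map `χ : F → S¹` (the unit circle `Circle ⊂ ℂ`)
the **rotation regluing**

  `Ψ_χ (f, v) = (f, χ(f) · v)`, `Ψ'_χ (f, v) = (f, χ(f)⁻¹ · v)`

(`S¹` acting on `ℝ² ≅ ℂ` by multiplication, through Mathlib's isometry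
`Complex.orthonormalBasisOneI.repr : ℂ ≃ₗᵢ[ℝ] ℝ²`) is a pair of mutually inverse, radius
preserving, conical maps, `C^∞` on ALL of `F × ℝ²` (a fortiori off the zero section) — the
hypotheses `hΨ … hcone` of `exists_tubeRegluing_boundaryGluingData` and of
`Literature.Barriers.SmoothPoincare4.akhmedovPark2010_lemma8_smooth_block_step`.  Everything is
PROVED; there is no definition and no named fact (the maps are bare expressions).

* `norm_rotate`, `rotate_inv_rotate`, `rotate_rotate_inv`, `rotate_smul` — the rotation
  `v ↦ repr (w * repr⁻¹ v)` by `w ∈ S¹` is norm preserving, inverted by `w⁻¹`, real-linear;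
* `contMDiff_rotationRegluing` — `(f, v) ↦ (f, χ(f) · v)` is `C^∞` for smooth `χ : F → S¹`
  (`S¹ ⊂ ℂ` is a submanifold, `contMDiff_coe_sphere`; complex multiplication and the isometry
  are smooth);
* `rotationRegluing_hypotheses` — the seven hypotheses of `TubeRegluing.lean` for the pair
  `(Ψ_χ, Ψ'_χ) = (Ψ_χ, Ψ_{χ⁻¹})`.

## References

* R. E. Gompf, A. I. Stipsicz, *4-Manifolds and Kirby Calculus*, GSM 20, AMS 1999, §8.3 p. 311.
  [GompfStipsiczGSM1999]
* S. Baldridge, P. Kirk, Geom. Topol. 12 (2008) 919–940, §2. [BaldridgeKirk2008]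
* A. Akhmedov, B. D. Park, Invent. Math. 181 (2010) 577–603, §2, §4, §9. [AkhmedovPark2010]
-/

noncomputable section

open scoped Manifold ContDiff Topology
open Set Function Metric Complex

namespace Literature.Topology.FourManifolds

/-! ### The rotation of `ℝ² ≅ ℂ` by a unit complex number -/

section Rotate

/-- **The rotation is norm preserving**: `‖repr (w * repr⁻¹ v)‖ = ‖v‖` for `w ∈ S¹`.
[folklore] -/
theorem norm_rotate (w : Circle) (v : EuclideanSpace ℝ (Fin 2)) :
    ‖Complex.orthonormalBasisOneI.repr ((w : ℂ) * Complex.orthonormalBasisOneI.repr.symm v)‖ =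
      ‖v‖ := by
  rw [LinearIsometryEquiv.norm_map, norm_mul, Circle.norm_coe, one_mul,
    LinearIsometryEquiv.norm_map]

/-- The rotation by `w⁻¹` undoes the rotation by `w`. [folklore] -/
theorem rotate_inv_rotate (w : Circle) (v : EuclideanSpace ℝ (Fin 2)) :
    Complex.orthonormalBasisOneI.repr (((w⁻¹ : Circle) : ℂ) *
      Complex.orthonormalBasisOneI.repr.symm
        (Complex.orthonormalBasisOneI.repr ((w : ℂ) * Complex.orthonormalBasisOneI.repr.symm v))) =
      v := by
  rw [LinearIsometryEquiv.symm_apply_apply, ← mul_assoc, ← Circle.coe_mul, inv_mul_cancel,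
    Circle.coe_one, one_mul, LinearIsometryEquiv.apply_symm_apply]

/-- The rotation by `w` undoes the rotation by `w⁻¹`. [folklore] -/
theorem rotate_rotate_inv (w : Circle) (v : EuclideanSpace ℝ (Fin 2)) :
    Complex.orthonormalBasisOneI.repr ((w : ℂ) *
      Complex.orthonormalBasisOneI.repr.symm
        (Complex.orthonormalBasisOneI.repr (((w⁻¹ : Circle) : ℂ) *
          Complex.orthonormalBasisOneI.repr.symm v))) =
      v := by
  rw [LinearIsometryEquiv.symm_apply_apply, ← mul_assoc, ← Circle.coe_mul, mul_inv_cancel,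
    Circle.coe_one, one_mul, LinearIsometryEquiv.apply_symm_apply]

/-- **The rotation is real-linear in `v`** (conicity): `w · (t v) = t (w · v)`. [folklore] -/
theorem rotate_smul (w : Circle) (t : ℝ) (v : EuclideanSpace ℝ (Fin 2)) :
    Complex.orthonormalBasisOneI.repr ((w : ℂ) * Complex.orthonormalBasisOneI.repr.symm (t • v)) =
      t • Complex.orthonormalBasisOneI.repr ((w : ℂ) * Complex.orthonormalBasisOneI.repr.symm v) := by
  have h1 : Complex.orthonormalBasisOneI.repr.symm (t • v) =
      t • Complex.orthonormalBasisOneI.repr.symm v :=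
    Complex.orthonormalBasisOneI.repr.symm.map_smul t v
  have h2 : ∀ z : ℂ, Complex.orthonormalBasisOneI.repr (t • z) =
      t • Complex.orthonormalBasisOneI.repr z :=
    fun z => Complex.orthonormalBasisOneI.repr.map_smul t z
  rw [h1, Complex.real_smul, mul_left_comm, ← Complex.real_smul, h2]

/-- Complex multiplication `S¹ × ℂ → ℂ`, `(w, z) ↦ w z`, is `C^∞` (`S¹ ⊂ ℂ` a submanifold).
[folklore] -/
theorem contMDiff_circle_coe_mul :
    ContMDiff ((𝓡 1).prod 𝓘(ℝ, ℂ)) 𝓘(ℝ, ℂ) ∞ (fun p : Circle × ℂ => (p.1 : ℂ) * p.2) := by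
  have hmul : ContMDiff (𝓘(ℝ, ℂ).prod 𝓘(ℝ, ℂ)) 𝓘(ℝ, ℂ) ∞ fun z : ℂ × ℂ => z.1 * z.2 := by
    rw [contMDiff_iff]
    exact ⟨continuous_mul, fun x y => contDiff_mul.contDiffOn⟩
  haveI : Fact (Module.finrank ℝ ℂ = 1 + 1) := finrank_real_complex_fact'
  have hcoe : ContMDiff (𝓡 1) 𝓘(ℝ, ℂ) ∞ (fun w : Circle => (w : ℂ)) := contMDiff_coe_sphere
  exact hmul.comp ((hcoe.comp contMDiff_fst).prodMk contMDiff_snd)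

end Rotate

/-! ### The rotation regluing of a tube `F × ℝ²` -/

section Regluing

variable {EF HF : Type*} [NormedAddCommGroup EF] [NormedSpace ℝ EF] [TopologicalSpace HF]
  {IF : ModelWithCorners ℝ EF HF} {F : Type*} [TopologicalSpace F] [ChartedSpace HF F]
  {χ : F → Circle}

/-- **The rotation regluing `(f, v) ↦ (f, χ(f) · v)` is `C^∞`** on all of `F × ℝ²`, for a
smooth `χ : F → S¹`. [folklore] -/
theorem contMDiff_rotationRegluing (hχ : ContMDiff IF (𝓡 1) ∞ χ) :
    ContMDiff (IF.prod (𝓡 2)) (IF.prod (𝓡 2)) ∞ fun q : F × EuclideanSpace ℝ (Fin 2) =>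
      ((q.1, Complex.orthonormalBasisOneI.repr
        ((χ q.1 : ℂ) * Complex.orthonormalBasisOneI.repr.symm q.2)) :
          F × EuclideanSpace ℝ (Fin 2)) := by
  refine contMDiff_fst.prodMk ?_
  have hrepr : ContMDiff 𝓘(ℝ, ℂ) (𝓡 2) ∞
      (fun z : ℂ => (Complex.orthonormalBasisOneI.repr z : EuclideanSpace ℝ (Fin 2))) :=
    (Complex.orthonormalBasisOneI.repr.toContinuousLinearEquiv.contDiff).contMDiff
  have hsymm : ContMDiff (𝓡 2) 𝓘(ℝ, ℂ) ∞
      (fun v : EuclideanSpace ℝ (Fin 2) => Complex.orthonormalBasisOneI.repr.symm v) :=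
    (Complex.orthonormalBasisOneI.repr.symm.toContinuousLinearEquiv.contDiff).contMDiff
  have hpair : ContMDiff (IF.prod (𝓡 2)) ((𝓡 1).prod 𝓘(ℝ, ℂ)) ∞
      fun q : F × EuclideanSpace ℝ (Fin 2) =>
        (χ q.1, Complex.orthonormalBasisOneI.repr.symm q.2) :=
    (hχ.comp contMDiff_fst).prodMk (hsymm.comp contMDiff_snd)
  exact hrepr.comp (contMDiff_circle_coe_mul.comp hpair)

/-- **The rotation regluing pair satisfies the hypotheses of `TubeRegluing.lean`.**  For a smooth
`χ : F → S¹` the maps `Ψ (f, v) = (f, χ(f) · v)` and `Ψ' (f, v) = (f, χ(f)⁻¹ · v)` are `C^∞`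
off the zero section (indeed everywhere), mutually inverse, radius preserving, and `Ψ` is
conical — the seven hypotheses `hΨ, hΨ', hΨΨ', hΨ'Ψ, hnΨ, hnΨ', hcone` of
`exists_tubeRegluing_boundaryGluingData` / `exists_smoothGlueData_reglue` (there with
`IF = 𝓡 d`) and of `Literature.Barriers.SmoothPoincare4.akhmedovPark2010_lemma8_smooth_block_step`.
With `F = T²` and `χ` the `n`-th power of an angular coordinate this is the gluing map of the
`(T, γ, n/1)` torus surgery — Luttinger surgery for `n = ±1` (Akhmedov–Park 2010 §2,
Baldridge–Kirk 2008 §2.2, Gompf–Stipsicz 1999 §8.3).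
[cite: GompfStipsiczGSM1999, §8.3 p. 311] [cite: AkhmedovPark2010, §2] -/
theorem rotationRegluing_hypotheses (hχ : ContMDiff IF (𝓡 1) ∞ χ) :
    let Ψ : F × EuclideanSpace ℝ (Fin 2) → F × EuclideanSpace ℝ (Fin 2) := fun q =>
      (q.1, Complex.orthonormalBasisOneI.repr
        ((χ q.1 : ℂ) * Complex.orthonormalBasisOneI.repr.symm q.2))
    let Ψ' : F × EuclideanSpace ℝ (Fin 2) → F × EuclideanSpace ℝ (Fin 2) := fun q =>
      (q.1, Complex.orthonormalBasisOneI.repr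
        (((χ q.1)⁻¹ : Circle) * Complex.orthonormalBasisOneI.repr.symm q.2))
    ContMDiffOn (IF.prod (𝓡 2)) (IF.prod (𝓡 2)) ∞ Ψ {q | q.2 ≠ 0} ∧
      ContMDiffOn (IF.prod (𝓡 2)) (IF.prod (𝓡 2)) ∞ Ψ' {q | q.2 ≠ 0} ∧
      (∀ q : F × EuclideanSpace ℝ (Fin 2), q.2 ≠ 0 → Ψ (Ψ' q) = q) ∧
      (∀ q : F × EuclideanSpace ℝ (Fin 2), q.2 ≠ 0 → Ψ' (Ψ q) = q) ∧
      (∀ q : F × EuclideanSpace ℝ (Fin 2), q.2 ≠ 0 → ‖(Ψ q).2‖ = ‖q.2‖) ∧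
      (∀ q : F × EuclideanSpace ℝ (Fin 2), q.2 ≠ 0 → ‖(Ψ' q).2‖ = ‖q.2‖) ∧
      (∀ (f : F) (u : EuclideanSpace ℝ (Fin 2)), ‖u‖ = 1 → ∀ t : ℝ, 0 < t →
        Ψ (f, t • u) = ((Ψ (f, u)).1, t • (Ψ (f, u)).2)) := by
  intro Ψ Ψ'
  have hχ' : ContMDiff IF (𝓡 1) ∞ fun f => (χ f)⁻¹ := hχ.inv
  refine ⟨(contMDiff_rotationRegluing hχ).contMDiffOn, (contMDiff_rotationRegluing hχ').contMDiffOn,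
    fun q _ => ?_, fun q _ => ?_, fun q _ => norm_rotate _ _, fun q _ => norm_rotate _ _,
    fun f u _ t _ => ?_⟩
  · exact Prod.ext rfl (rotate_rotate_inv (χ q.1) q.2)
  · exact Prod.ext rfl (rotate_inv_rotate (χ q.1) q.2)
  · exact Prod.ext rfl (rotate_smul (χ f) t u)

end Regluing

end Literature.Topology.FourManifolds
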